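import Summits.BirchSwinnertonDyer.Rank1Residual.X12.CMRamifiedRecordSchemaB
import HarnessLib

/-!
# Leaf `CornerF ∧ p ramified in K` (K12r): certificate-record schema, PART D — the «3-UNIT REGIME»
# census records of the slice `p = 3` (cell `bsd-print-cfram`, typer seat `ty3`; addendum to
# `X12/CMRamifiedRecordSchema{,B,C}.lean`; the per-class hypotheses of Kriz–Li 2019 Thm. 1.20 + Rem. 3.10
# AT `p = 3` in the kernel shape `X12.JZeroThree.bsdp_three_of_thm120_unitRegime` (p4, p538400) with
# `ψ = χ_{d*}` (p3, `Theorems/PrintCFramJZeroThreeTraceForm.lean` p542185), as censused by p3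
# (HOME/P3-UNIT-REGIME-CENSUS.md, PARI kit j282333) and recomputed by an independent second engine)

HONEST FRAMING (cell `bsd-print-cfram`, run/shared/lean/pub/bsd-print-cfram/, verbatim in every file
of the cell): PARTITION currency only — the leaf counts when its class theorem is in the kernel BY
NAME, flag-free; Literature named facts are statement-only with cite tags, never sorried theorems;
every imported theorem carries its printed hypotheses verbatim; numbers, not adjectives. THIS FILE IS
DATA INFRASTRUCTURE (computable records, a decidable recheck); nothing about any elliptic curve is
asserted, no named fact is introduced, nothing is booked, no mark moves (the leaf K12r and its `p = 3`
slice `Summit.BirchSwinnertonDyer.WAllCornerFRamifiedAtThree` stay OPEN). A class being «in the 3-unit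
regime» is a CENSUS statement about the DECIDABLE / NUMERIC hypotheses of the kernel theorem; the
Heegner-point DATA binders (`D`, `H`, `P`, `crd`, `g`), the PUB facts (`hKL`, `hRem`, GZ, Kolyvagin,
GZK, modularity, Burungale–Flach for the twin) and the `3`-descent certificates are NOT re-decided
here (see `X12/JZeroThreeUnitRegime.lean`, `X12/JZeroThreeRecords*.lean`).

## What a `UnitRegimeThreeRow` records (one per K12r@3 class: the 98 of the window `N < 2·10⁴` + the
## two beyond-window EXCESS-2 classes `309123c/d`)

For each `j = 0` member `E = E_k` (`k` sixth-power-free; the two members of the `3`-isogeny edge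
`E_k — E_{−27k}`, numbered as in Cremona) — MEMBER LEVEL (independent of the Heegner field):
* `d` = the square-free kernel of `k` (sign kept; recomputed from a recorded factorisation of `|k|`),
  `d* :=` the representative UNRAMIFIED at `3` of the square-class pair `{d, −3d}` (`d* = d` if `3 ∤ d`,
  else `−d/3`; `E_k ≅ y² = x³ + d*·m²` or its `3`-isogenous partner), `D* = disc ℚ(√d*)` = the conductor
  of `ψ := χ_{d*}` (prime to `3`), `D2 = disc ℚ(√(−3d*))` (the character `ψω`); for this `ψ` the
  trace congruence `hss` of the kernel theorem HOLDS (`PrintCFram.lFunction_modEq_three_of_sq_twist`,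
  p542185);
* `h1` = KL (1) at `3`: `ψ(3) ≠ 1 ∧ (ψ⁻¹ω)(3) ≠ 1` ⟺ `χ_{D*}(3) = −1` ⟺ `D* ≡ 2 (mod 3)` (`ψ` is
  unramified at `3`; `(ψω)(3) = 0`); `h3` = KL (3): at every bad `ℓ ≠ 3`, `ψ(ℓ) ≠ 1 ∧ (ψω)(ℓ) ≠ 1`
  as PRIMITIVE characters (value `0` at `ℓ ∣ D`; Legendre symbol by Euler's criterion, Kronecker
  symbol at `2`); both DECIDED IN THE KERNEL from `k`'s factorisation and `N`'s;
* `tam` = `(ℓ, c_ℓ)` at the bad primes (two engines, PART C), `v3tam = v₃(∏ c_ℓ)` (binder `htamW`: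
  `3 ∤ ∏ c_ℓ`), `c₃`, `tors3Q = (3 ∣ #E(ℚ)_tors)`, `lev3 = v₃(log_ω P)` for the generator `P` (PART C's
  `vlog`, three engines; binder `hg0` ⟺ `lev3 = 0` because the Heegner field is split at `3`);
* `blocked := ¬h1 ∨ ¬h3 ∨ v3tam ≠ 0 ∨ lev3 ≠ 0` — a member failing a field-independent hypothesis.
FIELD LEVEL, for a non-blocked member and each of the first six admissible Heegner discriminants `D_K`
of p3's census (`D_K < −4` fundamental, every prime of `N` split in `K` — both RECHECKED here:
`isFundamentalByFactors`, `splitIn`):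
* `tors3K = (3 ∣ #E(K)_tors)` (binder `hiv` ⟺ `¬tors3K`);
* the Bernoulli block of Thm. 1.20 read through `B_{1,χ_D} = −2h(D)/w(D)` for odd quadratic `χ_D`:
  the two discriminants are `D1 = disc ℚ(√(d*·D_K))`, `D2' = D2` if `d* > 0`, and `D1 = D*`,
  `D2' = disc ℚ(√(−3d*·D_K))` if `d* < 0` (RECOMPUTED: square-free kernels of products of coprime-reduced
  square-free numbers via `gcd`); their CLASS NUMBERS `hD1, hD2` (two engines: PARI `qfbclassno` =
  `quadclassunit` ‖ a count of reduced primitive forms), `b_i = v₃(B_{1,χ_{D_i}})` (`D = −3 ↦ −1`,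
  `D = −4 ↦ 0`, else `v₃(h(D))`), `bern := (b1 + b2 ≤ 0)` (binder `hB`);
* the TWIN `E^{(D_K)}` (minimal model): conductor, root number, `twinRank` (`0` iff `L(E^{D_K},1) ≠ 0`:
  ENGINE A PARI `ellanalyticrank`, ENGINE B Sage's exponentially convergent series `lseries().at1` with
  error bound, `|L(1)| > 10·err`), `#tors`, `∏ c_ℓ`, `#Ш_an` rounded (two engines, `|Ш_an − round| <
  10⁻²`), and `twinOK := twinRank = 0 ∧ 3 ∤ #Ш_an(E^{D_K}) ∧ 3 ∤ ∏ c_ℓ(E^{D_K})` (binders `hLt`,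
  `hSd` via Burungale–Flach, `htam`);
* `good := ¬tors3K ∧ bern ∧ twinOK`.
CLASS LEVEL: `eligible := ∃ member ¬blocked ∧ ∃ field good` with a recorded WITNESS `(witnessNum,
witnessDK)`; and the census fact that makes the verdict FIELD-INDEPENDENT on this window:
`¬eligible → every member is blocked` (so a non-eligible class fails KL (1), KL (3), `3 ∤ ∏c_ℓ` or the
level-`0` condition on BOTH members — no Heegner field can repair it); `status` = booked by a printed
family before (PART B's `ThreeMetaRow.status`). `UnitRegimeThreeRow.consistent` rechecks everything
named above on the recorded integers; NOT rechecked (engines' work): `c_ℓ`, `#tors`, `lev3`, torsion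
over `K`, class numbers, the twin's `L`-data.

ENGINES: A = p3's PARI/GP census (`census.gp`, kit j282333: `core`, `kronecker`, `ellglobalred`,
`elltors` over `ℚ` and `K`, `ellformallog`, `qfbclassno`, `elltwist`+`ellanalyticrank`+`ellbsd`) and
ty3's PARI class-number job (`qfbclassno` ‖ `quadclassunit`); B = ty3's SageMath job (Sage `factor`/
`kronecker`, Tate `local_data`, `torsion_order` over `ℚ` and over `K`, `BinaryQF_reduced_representatives`,
`quadratic_twist().minimal_model()`, `root_number`, `lseries().at1`, `period_lattice().omega`); kit jobs
named in the display files.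

References: `X12/JZeroThreeUnitRegime.lean` (the kernel shape and its binders);
`Theorems/PrintCFramJZeroThreeTraceForm.lean` (`hss` for `ψ = χ_{d*}`); HOME/P3-UNIT-REGIME-CENSUS.md;
`X12/CMRamifiedRecordSchema{,B,C}.lean` (helpers reused, nothing re-declared); [KrizLi2019] Thm. 1.20,
Rem. 1.21, Rem. 3.10, §7 (p = 3: all characters quadratic, `3 ∤ h`), Thm. 10.6; [cite: Washington1997,
Thm. 4.17 (B_{1,χ} = −h/w… class number formula for imaginary quadratic χ)]; [Cremona1997] `ecdata`.
-/

set_option autoImplicit false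

namespace Summit.BirchSwinnertonDyer.Rank1Residual.X12.CMRamifiedRecords

open Summit.BirchSwinnertonDyer.BirchSwinnertonDyer.Rank1Residual.HeegnerIndexRecords
open Summit.BirchSwinnertonDyer.Rank1Residual.X10.JetchevTamagawaRecords (c6 isNonzeroSquareMod tamAt)

/-! ### §1 Helpers (computable; integer arithmetic only) -/

/-- The square-free kernel of a non-zero integer with its sign, `core k = sign(k)·∏ p^{e mod 2}`, read
off a recorded prime factorisation of `|k|`. [folklore] -/
def coreByFactors (k : ℤ) (fs : List (ℕ × ℕ)) : ℤ :=
  (if k < 0 then -1 else 1) * fs.foldl (fun acc qe => if qe.2 % 2 == 1 then acc * (qe.1 : ℤ) else acc) 1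

/-- The representative unramified at `3` of the square-class pair `{d, −3d}` (`d` square-free):
`d` if `3 ∤ d`, else `−d/3`. [folklore] -/
def dstarOf (d : ℤ) : ℤ := if d % 3 == 0 then -(d / 3) else d

/-- The discriminant of `ℚ(√d)` for square-free `d ≠ 1`: `d` if `d ≡ 1 (mod 4)`, else `4d`. [folklore] -/
def fdisc (d : ℤ) : ℤ := if d % 4 == 1 then d else 4 * d

/-- The value at a prime `ℓ` of the PRIMITIVE quadratic character of discriminant `D`: `0` if `ℓ ∣ D`;
at odd `ℓ` the Legendre symbol (Euler's criterion, `isNonzeroSquareMod`); at `ℓ = 2` the Kronecker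
symbol of an odd `D` (`+1` iff `D ≡ ±1 (mod 8)`). [folklore] -/
def chiVal (D : ℤ) (l : ℕ) : ℤ :=
  if D % (l : ℤ) == 0 then 0
  else if l == 2 then (if D % 8 == 1 || D % 8 == 7 then 1 else -1)
  else if isNonzeroSquareMod D l then 1 else -1

/-- KL (1) at `p = 3` for `ψ = χ_{D*}` (`3 ∤ D*`): `χ_{D*}(3) = −1`, i.e. `D* ≡ 2 (mod 3)`.
[cite: KrizLi2019, Thm. 1.20 hypothesis (1) and proof of Thm. 10.6] -/
def klH1 (Dstar : ℤ) : Bool := Dstar % 3 == 2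

/-- KL (3): at every bad prime `ℓ ≠ 3` (read off the factorisation of `N`), `ψ(ℓ) ≠ 1` and
`(ψω)(ℓ) ≠ 1` as primitive characters (`ψ ↔ D*`, `ψω ↔ D2`). [cite: KrizLi2019, Thm. 1.20 hypothesis (3)] -/
def klH3 (Dstar D2 : ℤ) (Nfactors : List (ℕ × ℕ)) : Bool :=
  Nfactors.all fun qe => qe.1 == 3 || (chiVal Dstar qe.1 != 1 && chiVal D2 qe.1 != 1)

/-- The square-free part of a fundamental discriminant: `D` if odd, `D/4` if even. [folklore] -/
def fundCore (D : ℤ) : ℤ := if D % 2 == 0 then D / 4 else D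

/-- The square-free kernel of a product of two square-free integers: `a·b / gcd(a,b)²`. [folklore] -/
def coreMul (a b : ℤ) : ℤ := a * b / ((Int.gcd a b : ℤ) ^ 2)

/-- `v₃(B_{1,χ_D})` for an odd quadratic character through the class number (`B_{1,χ_D} = −2h(D)/w(D)`):
`D = −3 ↦ −1`, `D = −4 ↦ 0`, otherwise `v₃(h(D))` with `h(D)` the recorded class number.
[cite: Washington1997, Thm. 4.17] -/
def bernVal (D : ℤ) (h : ℕ) : ℤ := if D == -3 then -1 else if D == -4 then 0 else (vp 3 h : ℤ)

/-- The Heegner hypothesis for `(N, D_K)`: every prime `q ∣ N` splits in `ℚ(√D_K)` (PART A's `splitIn`).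
[cite: GrossZagier1986, I.§3 (Heegner hypothesis)] -/
def heegnerOK (DK : ℤ) (Nfactors : List (ℕ × ℕ)) : Bool := Nfactors.all fun qe => splitIn DK qe.1

/-! ### §2 The record types -/

/-- FIELD-LEVEL row: one admissible Heegner discriminant `D_K` for one member (module docstring): torsion
over `K`, the Bernoulli discriminants with class numbers and valuations, the twin `E^{(D_K)}`'s data,
the bits `bern`, `twinOK`, and engine counts. [folklore] -/
structure URField where
  DK : ℤ
  DKfactors : List (ℕ × ℕ)
  tors3K : Bool
  D1 : ℤ
  hD1 : ℕ
  D2' : ℤ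
  hD2 : ℕ
  b1 : ℤ
  b2 : ℤ
  bern : Bool
  twinN : ℕ
  twinRootNo : ℤ
  twinRank : ℕ
  twinTors : ℕ
  twinTam : ℕ
  twinShaAn : ℕ
  twinOK : Bool
  classNoEngines : ℕ
  twinEngines : ℕ

/-- The recheck of a field row against its member's `d*`, `D*`, `D2` and the class's `N`. [folklore] -/
def URField.okWith (dstar Dstar D2 : ℤ) (Nfactors : List (ℕ × ℕ)) (f : URField) : Bool :=
  decide (f.DK < -4) && isFundamentalByFactors f.DK f.DKfactors && heegnerOK f.DK Nfactors &&
  (f.D1 == (if decide (0 < dstar) then fdisc (coreMul dstar (fundCore f.DK)) else Dstar)) &&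
  (f.D2' == (if decide (0 < dstar) then D2 else fdisc (coreMul (-3 * dstar) (fundCore f.DK)))) &&
  decide (1 ≤ f.hD1) && decide (1 ≤ f.hD2) &&
  (f.b1 == bernVal f.D1 f.hD1) && (f.b2 == bernVal f.D2' f.hD2) && (f.bern == decide (f.b1 + f.b2 ≤ 0)) &&
  (f.twinRootNo == 1 || f.twinRootNo == -1) && (f.twinRootNo == 1 || f.twinRank != 0) &&
  (f.twinOK == (f.twinRank == 0 && decide (1 ≤ f.twinShaAn) && vp 3 f.twinShaAn == 0 && vp 3 f.twinTam == 0)) &&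
  decide (2 ≤ f.classNoEngines) && decide (2 ≤ f.twinEngines)

/-- A field row is GOOD: `E(K)[3] = 0`, the Bernoulli unit condition, and the twin conditions. [folklore] -/
def URField.good (f : URField) : Bool := !f.tors3K && f.bern && f.twinOK

/-- MEMBER-LEVEL row (module docstring): model, `k` with factorisation and `k`-identity scaling, `d`,
`d*`, `D*`, `D2`, `h1`, `h3`, Tamagawa list, `v3tam`, `c₃`, `tors3Q`, `lev3`, `blocked`, and the field
rows (empty for a blocked member). [folklore] -/
structure URMember where
  num : ℕ
  ainvs : List ℤ
  k : ℤ
  kfactors : List (ℕ × ℕ)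
  u1 : ℕ
  u2 : ℕ
  d : ℤ
  dstar : ℤ
  Dstar : ℤ
  D2 : ℤ
  h1 : Bool
  h3 : Bool
  tam : List (ℕ × ℕ)
  v3tam : ℕ
  c3 : ℕ
  tors3Q : Bool
  lev3 : ℤ
  blocked : Bool
  fields : List URField

/-- The recheck of a member row against the class's factorisation of `N`. [folklore] -/
def URMember.okWith (Nfactors : List (ℕ × ℕ)) (m : URMember) : Bool :=
  (m.ainvs.length == 5) && (c4 m.ainvs == 0) && decide (1 ≤ m.u1) && decide (1 ≤ m.u2) &&
  (c6 m.ainvs * (m.u1 : ℤ) ^ 6 == -864 * m.k * (m.u2 : ℤ) ^ 6) && sixthPowerFreeByFactors m.k m.kfactors &&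
  (m.d == coreByFactors m.k m.kfactors) && (m.dstar == dstarOf m.d) && (m.dstar % 3 != 0) &&
  (m.Dstar == fdisc m.dstar) && (m.D2 == fdisc (-3 * m.dstar)) &&
  (m.h1 == klH1 m.Dstar) && (m.h3 == klH3 m.Dstar m.D2 Nfactors) &&
  (m.tam.map Prod.fst == Nfactors.map Prod.fst) &&
  (m.v3tam == vp 3 (m.tam.foldl (fun acc qc => acc * qc.2) 1 : ℕ)) && (tamAt m.tam 3 == m.c3) &&
  (m.blocked == (!m.h1 || !m.h3 || m.v3tam != 0 || m.lev3 != 0)) &&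
  (!m.blocked || m.fields.isEmpty) &&
  m.fields.all (URField.okWith m.dstar m.Dstar m.D2 Nfactors)

/-- **«3-unit regime» census record of a K12r@3 class** (module docstring): the two `j = 0` members with
their member-level hypotheses and field rows, `status` (booked by a printed family before), the
`eligible` bit with its witness `(witnessNum, witnessDK)`, and provenance. [folklore] -/
structure UnitRegimeThreeRow where
  label : String
  cls : String
  N : ℕ
  Nfactors : List (ℕ × ℕ)
  status : ℕ
  members : List URMember
  eligible : Bool
  witnessNum : ℕ
  witnessDK : ℤ
  engines : String

namespace UnitRegimeThreeRow

/-- **The in-kernel recheck of a `UnitRegimeThreeRow`**: `N`'s factorisation, every member row (and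
through it every field row), `eligible ↔ ∃ non-blocked member with a good field row`, the witness is
such a pair, and `¬eligible → every member blocked`. [folklore] -/
def consistent (r : UnitRegimeThreeRow) : Bool :=
  factorsOK r.N r.Nfactors && decide (1 ≤ r.members.length) && (r.status == 0 || r.status == 1) &&
  r.members.all (URMember.okWith r.Nfactors) &&
  (r.eligible == r.members.any (fun m => !m.blocked && m.fields.any URField.good)) &&
  (!r.eligible || r.members.any (fun m => m.num == r.witnessNum && !m.blocked &&
    m.fields.any (fun f => f.DK == r.witnessDK && f.good))) &&
  (r.eligible || r.members.all URMember.blocked)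

/-- A consistent ELIGIBLE record has a non-blocked member `witnessNum` with a good field row at
`witnessDK`. [folklore] -/
theorem witness_of_consistent {r : UnitRegimeThreeRow} (h : r.consistent = true)
    (he : r.eligible = true) :
    ∃ m ∈ r.members, m.num = r.witnessNum ∧ m.blocked = false ∧
      ∃ f ∈ m.fields, f.DK = r.witnessDK ∧ f.good = true := by
  simp only [consistent, Bool.and_eq_true, Bool.or_eq_true, Bool.not_eq_true', beq_iff_eq,
    decide_eq_true_eq] at h
  obtain ⟨⟨⟨-, -⟩, hw⟩, -⟩ := h
  rcases hw with hw | hw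
  · rw [he] at hw; exact absurd hw (by decide)
  · obtain ⟨m, hm, hmw⟩ := List.any_eq_true.1 hw
    simp only [Bool.and_eq_true, beq_iff_eq, Bool.not_eq_true'] at hmw
    obtain ⟨⟨hnum, hb⟩, hf⟩ := hmw
    obtain ⟨f, hfm, hfw⟩ := List.any_eq_true.1 hf
    simp only [Bool.and_eq_true, beq_iff_eq] at hfw
    exact ⟨m, hm, hnum, hb, f, hfm, hfw.1, hfw.2⟩

/-- A consistent NON-eligible record has every member blocked (it fails KL (1), KL (3), `3 ∤ ∏c_ℓ` or
the level-`0` condition — independently of the Heegner field). [folklore] -/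
theorem all_blocked_of_consistent {r : UnitRegimeThreeRow} (h : r.consistent = true)
    (he : r.eligible = false) : ∀ m ∈ r.members, m.blocked = true := by
  simp only [consistent, Bool.and_eq_true, Bool.or_eq_true, beq_iff_eq, decide_eq_true_eq] at h
  obtain ⟨-, hall⟩ := h
  rcases hall with hall | hall
  · rw [he] at hall; exact absurd hall (by decide)
  · exact List.all_eq_true.1 hall

/-- The member-level meaning of `blocked` on a consistent record. [folklore] -/
theorem blocked_eq_of_consistent {r : UnitRegimeThreeRow} (h : r.consistent = true)
    {m : URMember} (hm : m ∈ r.members) :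
    m.blocked = (!m.h1 || !m.h3 || m.v3tam != 0 || m.lev3 != 0) := by
  simp only [consistent, Bool.and_eq_true] at h
  obtain ⟨⟨⟨⟨-, hmem⟩, -⟩, -⟩, -⟩ := h
  have hm' := List.all_eq_true.1 hmem m hm
  simp only [URMember.okWith, Bool.and_eq_true] at hm'
  obtain ⟨⟨⟨-, hb⟩, -⟩, -⟩ := hm'
  simpa only [beq_iff_eq] using hb

end UnitRegimeThreeRow

/-- Unpacking a display theorem `rs.all UnitRegimeThreeRow.consistent = true` per member. [folklore] -/
theorem UnitRegimeThreeRow.consistent_of_all {rs : List UnitRegimeThreeRow}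
    (h : rs.all UnitRegimeThreeRow.consistent = true) {r : UnitRegimeThreeRow} (hr : r ∈ rs) :
    r.consistent = true :=
  List.all_eq_true.1 h r hr

end Summit.BirchSwinnertonDyer.Rank1Residual.X12.CMRamifiedRecords
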